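import Summits.CriticalPhenomena.SAWScalingLimit.Theses.SAWEdgeOfPositiveType

/-!
# Birth skeleton (BC3) for the crux `SAWEdgeOfPositiveType.AveragedTubeMass`
(crux item stmt-CriticalPhenomena-8259, rank 3 of `route-CriticalPhenomena-SAWEdgeOfPositiveType`;
skeleton registrar planner-skel-stmt-CriticalPhenomena-8259-0, 2026-08-17; tree path
`Summits/CriticalPhenomena/SAWScalingLimit/Cruxes/AveragedTubeMass/Lines/birth.lean`.)

Crux (FIXED, by name): `AveragedTubeMass` — there are `α < 1`, `C`, `c > 0` such that for all `u v ∈ ℤ²` and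
`ℓ ≥ 1` with `|u − v| ≤ ℓ` some partial sum of the `x_c`-mass of self-avoiding walks from `u` whose vertices stay
within `ℓ/10 + 2` of the segment `[u, v]` and whose endpoint lies within `ℓ^α` of `v` is `≥ c ℓ^{−C}`.

## The line: TRANSPORT ⊗ FOCUSING, spliced at the first entrance into a mesoscopic ball (3 registered stubs)

The averaged crux has two visibly different difficulties: (T) LENGTHWISE TRANSPORT — a walk started at the bulk
point `u` must travel distance `≈ ℓ` along a tube of half-width `ℓ/10 + 2` (a one-arm, hard-way crossing event
for a bulk-started prefix-complete family), and (F) FOCUSING — near `v` it must land in the mesoscopic ball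
`B(v, ℓ^α)`, `ℓ^α ≪ ℓ/10`.  The line separates them at the sphere of radius `r ≍ ℓ/20` around `v`:

* S1 `stub_tubeEntranceFloor` (OPEN, conjecture-grade; transport): `TubeEntranceFloor` — the `x_c`-mass of
  tube-confined walks from `u` STOPPED AT THEIR FIRST ENTRANCE into the closed ball `B̄(v, r)` (all earlier
  vertices at distance `> r` from `v`, the last one at distance `≤ r`), for any entrance radius
  `ℓ/20 ≤ r ≤ ℓ/10 + 2`, is `≥ c₁ ℓ^{−C₁}`.  A macroscopic target (radius `∝ ℓ`), no focusing; a first-entrance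
  (stopping-time) family, the shape in which Simon–Lieb / renewal arguments produce floors.
* S2 `stub_ballFunnelFloor` (OPEN, conjecture-grade; focusing, the HARDEST stub): `BallFunnelFloor` — for every
  centre `v`, radius `r ≥ 1` and START `w` anywhere in `B̄(v, r)` (in particular on its boundary layer, where the
  entrance point of S1 sits), the `x_c`-mass of walks from `w` confined to `B̄(v, r)` and ending within `r^α` of
  `v` is `≥ c₂ r^{−C₂}`, some `0 ≤ α < 1`.  Aspect ratio one, no tube; a boundary-started floor with a
  mesoscopic target.
* S3 `stub_entranceSplice` (PROVABLE NOW, M/L; the structural lemma): `EntranceSplice` — PINCHED CONCATENATION: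
  a first-entrance prefix (vertices before the entrance time at distance `> r` from `v`) and a ball-confined
  suffix from the entrance point (all vertices at distance `≤ r`) have disjoint vertex sets, so their
  concatenation is self-avoiding; it is tube-confined because `B̄(v, r) ⊂` tube when `r ≤ ℓ/10 + 2`
  (`Metric.infDist z [u,v] ≤ dist z v`); the map (prefix, suffix) ↦ walk is injective (the entrance time is
  the first index at distance `≤ r`), weights multiply, and the finitely many entrance points let one take a
  common cut-off `N`.  Output: floor(target family, landing radius `a`) `≥ F₁ · F₂` whenever `F₁` is a floor for
  the entrance family and `F₂ ≥ 0` a floor for the funnel family uniformly over the start `w ∈ B̄(v, r)`.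
  Tools: `Zd.mem_saws` (SAWCount.lean), the cut/glue idioms of `LiebSimon.prefix_mem_saws` /
  `suffix_mem_saws` (Theorems/SAWRenewalTightnessTubeLowerBound*.lean), `Finset.sum_sigma'`,
  `Finset.card_le_card_of_injOn` / `Finset.sum_le_sum_of_subset_of_nonneg`.

The composition (kernel-checked real-variable glue; hypothesis form `AveragedTubeMass_of_stubs : S1-sig → S2-sig →
S3-sig → AveragedTubeMass`, sorry-free, and the registered form `AveragedTubeMass_of : AveragedTubeMass` = it applied to
the three `stub_*` theorems): for `ℓ ≥ 1` take
the entrance radius `r := (ℓ + 19)/20` (so `1 ≤ r ≤ ℓ`, `ℓ/20 ≤ r ≤ ℓ/10 + 2`), apply S3 to the floors of S1 and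
S2, and absorb the constants: `c₁ ℓ^{−C₁} · c₂ r^{−C₂} ≥ c₁ c₂ ℓ^{−(C₁+C₂)}` (`r ≤ ℓ`, `C₂ ≥ 0`) and
`r^α ≤ ℓ^α` (`α ≥ 0`), i.e. the landing family at radius `r^α` is contained in the crux's family at radius `ℓ^α`.
Output constants: `α` of S2, `C = C₁ + C₂`, `c = c₁ c₂`.

Why this is not the dead pointwise chain of the sibling crux `TubeLowerBound` (stmt-4730, `Cruxes/TubeLowerBound/
STRATEGY-CENSUS.md`): every registered line there had to chain ≥ 10 pieces at BULK junctions (unpinched ⇒ a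
two-point CEILING is needed, face (C) = polynomial Hammersley–Welsh) or at boundary junctions across `≍ log ℓ`
geometric scales.  The averaged crux needs exactly ONE junction, and the line pinches it on a sphere (free
concatenation, S3), so no ceiling enters; the price is that S2 is boundary-started (face (F1)-type) — named and
isolated at aspect ratio one, with the mesoscopic target that distinguishes this crux.

Negatives honoured (no `Disproof.lean` exists yet for this crux; the importable negatives of the sibling crux
`Theorems/TubeLowerBound/Negative/*` are the relevant shape constraints): criticality is used (S1, S2 are at
`x = x_c`; cf. `not_atFugacity_of_lt`), the tube WIDENS with `ℓ` and keeps the `+2` slack (S1's family is the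
crux's tube verbatim; cf. `not_withoutDist`, `not_withoutSlack`), all masses are `∃ N` partial sums (cf.
`not_allN`), floors carry `0 ≤ C` (cf. `constraints`).  `ledger negatives --problem CriticalPhenomena`: no
refuted statement concerns entrance/funnel floors (checked 2026-08-17).

BC3 AUDIT (registrar, 2026-08-17, `lean check --json` on this file): rc 0, errors [], sorries 3 = the three
`stub_*` declarations (lines of `stub_tubeEntranceFloor`, `stub_ballFunnelFloor`, `stub_entranceSplice`), zero
elsewhere; audit: `AveragedTubeMass_of_stubs` has target
`Summit.CriticalPhenomena.SAWScalingLimit.Theses.SAWEdgeOfPositiveType.AveragedTubeMass` (the route decl BY NAME)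
under exactly the hypotheses `TubeEntranceFloor`, `BallFunnelFloor`, `EntranceSplice` (axioms propext,
Classical.choice, Quot.sound — no sorryAx), and `AveragedTubeMass_of` is proof-of-item of the route decl modulo the
stubs' `sorryAx`; `ledger skeleton check … --crux stmt-CriticalPhenomena-8259` records the three stub names.
BC3 PROBES (files `bc/probe_<Def>_{crux,summit}.lean` in the registrar's folder; each runs, under
`set_option maxHeartbeats 400000`, the combined `first | exact? | simpa [Def] | (unfold Def; simpa) | aesop` AND the
four alternatives one by one, because a heartbeat time-out inside `first` is not caught): all 30 examples FAIL —
for each of `TubeEntranceFloor`, `BallFunnelFloor`, `EntranceSplice` against BOTH `AveragedTubeMass` and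
`_root_.SAWScalingLimit`: combined probe = deterministic time-out in `simp`/`whnf` (error), `exact?` = "could not
close the goal" (one instance: time-out), `simpa [Def]` and `unfold Def; simpa` = "Tactic `assumption` failed" with
the unfolded implication as the residual goal, `aesop` = "failed to prove the goal after exhaustive search" (rc 1 for
all six files).  No stub is cheaply the crux or the summit.
-/

noncomputable section

namespace Summit.CriticalPhenomena.SAWScalingLimit.Cruxes.AveragedTubeMass.Birth

open scoped BigOperators Classical
open Literature.Probability.LatticeModels
open Literature.Probability.RandomPlanarGeometry Literature.Probability.RandomPlanarGeometry.SAW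
open Summit.CriticalPhenomena.SAWScalingLimit.Theses.SAWEdgeOfPositiveType (AveragedTubeMass)

set_option linter.unusedVariables false

/-! ## Statements of the line (local `def`s over tree vocabulary: `Zd.saws`, `criticalFugacity`, `Site.toComplex`) -/

/-- **(T) Tube entrance floor.**  For all `u, v`, `ℓ ≥ max(1, |u − v|)` and entrance radii
`ℓ/20 ≤ r ≤ ℓ/10 + 2`: the `x_c`-mass of self-avoiding walks from `u`, all of whose vertices lie within
`ℓ/10 + 2` of `[u, v]`, whose vertices before the last lie at distance `> r` from `v` and whose last vertex lies
at distance `≤ r` from `v` (first entrance into `B̄(v, r)`), is `≥ c ℓ^{−C}` (some partial sum). -/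
def TubeEntranceFloor : Prop :=
  ∃ C c : ℝ, 0 ≤ C ∧ 0 < c ∧ ∀ (u v : Site 2) (ℓ r : ℝ), 1 ≤ ℓ →
    dist (Site.toComplex u) (Site.toComplex v) ≤ ℓ → ℓ / 20 ≤ r → r ≤ ℓ / 10 + 2 →
    ∃ N : ℕ, c * ℓ ^ (-C) ≤ ∑ n ∈ Finset.range (N + 1), ∑ _ω ∈ (Zd.saws 2 n).filter (fun ω =>
      (∀ i ≤ n, Metric.infDist (Site.toComplex (u + ω i))
        (segment ℝ (Site.toComplex u) (Site.toComplex v)) ≤ ℓ / 10 + 2) ∧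
      (∀ i < n, r < dist (Site.toComplex (u + ω i)) (Site.toComplex v)) ∧
      dist (Site.toComplex (u + ω n)) (Site.toComplex v) ≤ r), criticalFugacity ^ n

/-- **(F) Ball funnel floor.**  There is `0 ≤ α < 1` such that for every centre `v`, radius `r ≥ 1` and start
`w` with `|w − v| ≤ r`: the `x_c`-mass of self-avoiding walks from `w` all of whose vertices stay in the closed
ball `B̄(v, r)` and whose last vertex lies within `r^α` of `v` is `≥ c r^{−C}` (some partial sum). -/
def BallFunnelFloor : Prop :=
  ∃ α C c : ℝ, 0 ≤ α ∧ α < 1 ∧ 0 ≤ C ∧ 0 < c ∧ ∀ (v w : Site 2) (r : ℝ), 1 ≤ r →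
    dist (Site.toComplex w) (Site.toComplex v) ≤ r →
    ∃ N : ℕ, c * r ^ (-C) ≤ ∑ n ∈ Finset.range (N + 1), ∑ _ω ∈ (Zd.saws 2 n).filter (fun ω =>
      (∀ i ≤ n, dist (Site.toComplex (w + ω i)) (Site.toComplex v) ≤ r) ∧
      dist (Site.toComplex (w + ω n)) (Site.toComplex v) ≤ r ^ α), criticalFugacity ^ n

/-- **(S) Entrance splice.**  Pinched concatenation at the first entrance into `B̄(v, r)`, `r ≤ ℓ/10 + 2`: a floor
`F₁` for the entrance family of (T) and a floor `F₂ ≥ 0` for the funnel family of (F), uniform over the start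
`w ∈ B̄(v, r)` and with landing radius `a`, give the floor `F₁ F₂` for tube-confined walks from `u` landing within
`a` of `v`. -/
def EntranceSplice : Prop :=
  ∀ (u v : Site 2) (ℓ r a F₁ F₂ : ℝ), 0 ≤ F₂ → r ≤ ℓ / 10 + 2 →
    (∃ N₁ : ℕ, F₁ ≤ ∑ n ∈ Finset.range (N₁ + 1), ∑ _ω ∈ (Zd.saws 2 n).filter (fun ω =>
      (∀ i ≤ n, Metric.infDist (Site.toComplex (u + ω i))
        (segment ℝ (Site.toComplex u) (Site.toComplex v)) ≤ ℓ / 10 + 2) ∧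
      (∀ i < n, r < dist (Site.toComplex (u + ω i)) (Site.toComplex v)) ∧
      dist (Site.toComplex (u + ω n)) (Site.toComplex v) ≤ r), criticalFugacity ^ n) →
    (∀ w : Site 2, dist (Site.toComplex w) (Site.toComplex v) ≤ r →
      ∃ N₂ : ℕ, F₂ ≤ ∑ n ∈ Finset.range (N₂ + 1), ∑ _ω ∈ (Zd.saws 2 n).filter (fun ω =>
        (∀ i ≤ n, dist (Site.toComplex (w + ω i)) (Site.toComplex v) ≤ r) ∧
        dist (Site.toComplex (w + ω n)) (Site.toComplex v) ≤ a), criticalFugacity ^ n) →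
    ∃ N : ℕ, F₁ * F₂ ≤ ∑ n ∈ Finset.range (N + 1), ∑ _ω ∈ (Zd.saws 2 n).filter (fun ω =>
      (∀ i ≤ n, Metric.infDist (Site.toComplex (u + ω i))
        (segment ℝ (Site.toComplex u) (Site.toComplex v)) ≤ ℓ / 10 + 2) ∧
      dist (Site.toComplex (u + ω n)) (Site.toComplex v) ≤ a), criticalFugacity ^ n

/-! ## Registered stubs (`sorry` only here) -/

/-- **S1 `stub_tubeEntranceFloor`** — `TubeEntranceFloor` (OPEN, conjecture-grade).  A bulk-started, one-arm,
prefix-complete (first-entrance) family crossing a tube of aspect `≈ 5 : 1` lengthwise, macroscopic target.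
In print: exponential-scale floors only (`b_n ≥ μ^n e^{−C√n}`, MadrasSlade1993 §1.2; p. 202 "no rigorous lower
bound `q_N ≥ const N^{−p} μ^N`"); in tree the Simon–Lieb first-exit saturation gives the 2 : 1 "domino" floors on
the 8 lattice rays (`Theorems/SAWRenewalTightnessTubeLowerBound*`: `dominoFloor_holds`, `stub_quarterFlux`);
longer aspect / general direction needs chaining (census face (F)/(C)).  Degenerate cases: `|u − v| ≤ r` ⇒ the
zero-step walk is in the family (mass `≥ 1`, so `c ≤ 1` is forced — fine for `∃ c`).  Cheapest falsifier: none
finite (`∃ C`); exact tube transfer matrices (sibling Disproof, `ℓ ≤ 59`) are consistent with a polynomial. -/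
theorem stub_tubeEntranceFloor : TubeEntranceFloor := by
  sorry

/-- **S2 `stub_ballFunnelFloor`** — `BallFunnelFloor` (OPEN, conjecture-grade; HARDEST).  Uniform over the start
`w ∈ B̄(v, r)`: for `w` in the boundary layer this is a BOUNDARY-STARTED floor (census face (F1): from a boundary
start the first-exit saturation is vacuous), with a mesoscopic target `B(v, r^α)`; SLE₈⸝₃/CFT predict a
polynomial (boundary exponent `5/8`, bulk `5/48`), hex has `B_T ≥ c/T` only through the parafermion
(DuminilCopinSmirnov2012).  Non-vacuity: the monotone staircase `w → v` stays in `B̄(v, r)` and lands AT `v`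
(mass `≥ x_c^{2r} > 0`).  Accepts any `0 ≤ α < 1` and any polynomial.  Cheapest falsifier: none finite; a proof
that boundary-to-centre disc masses decay super-polynomially kills the line (and contradicts SLE₈⸝₃). -/
theorem stub_ballFunnelFloor : BallFunnelFloor := by
  sorry

/-- **S3 `stub_entranceSplice`** — `EntranceSplice` (PROVABLE NOW, M/L).  Route: cut-off `N := N₁ + N₂*`,
`N₂* := max` of the `N₂(w)` over the finitely many lattice points `w ∈ B̄(v, r)` (partial sums are monotone,
terms `x_c^n ≥ 0`); injection `(ω₁, ω₂) ↦ ω`, `ω i = ω₁ i (i ≤ n₁)`, `ω (n₁ + j) = ω₁ n₁ + ω₂ j (j ≤ n₂)`, frozen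
after `n₁ + n₂`; `ω ∈ Zd.saws 2 (n₁+n₂)` by `Zd.mem_saws` (adjacency piecewise; injectivity: indices `< n₁` carry
vertices at distance `> r` from `v`, indices `≥ n₁` at distance `≤ r`, and each piece is injective); tube
condition on the suffix from `Metric.infDist_le_dist_of_mem` (`v ∈ segment`, `right_mem_segment`) and
`r ≤ ℓ/10 + 2`; endpoint `= w + ω₂ n₂`; injectivity of the map: `n₁` is the least index at distance `≤ r`;
then `∑ target ≥ ∑_{ω₁} x_c^{n₁} ∑_{ω₂} x_c^{n₂} ≥ (∑_{ω₁} x_c^{n₁}) F₂ ≥ F₁ F₂` (`Finset.sum_sigma'`,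
`Finset.sum_le_sum_of_subset_of_nonneg` on the image, `pow_add`). -/
theorem stub_entranceSplice : EntranceSplice := by
  sorry

/-! ## Composition (kernel-checked, no `sorry`): the three stubs imply the crux BY NAME -/

/-- `0 < x_c` (from `μ(ℤ²) > 0`, in tree). [folklore] -/
theorem criticalFugacity_pos' : 0 < criticalFugacity := by
  have h := Zd.connectiveConstant_pos 2
  rw [Zd.connectiveConstant_two] at h
  unfold criticalFugacity
  exact inv_pos.2 h

/-- **`AveragedTubeMass_of_stubs`** — the hypothesis form of the composition: S1 → S2 → S3 → the crux
`SAWEdgeOfPositiveType.AveragedTubeMass` (sorry-free; axioms `propext`, `Classical.choice`, `Quot.sound`).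
Real-variable glue: entrance radius `r = (ℓ + 19)/20`, constants `α` (of S2), `C = C₁ + C₂`, `c = c₁ c₂`. -/
theorem AveragedTubeMass_of_stubs :
    TubeEntranceFloor → BallFunnelFloor → EntranceSplice → AveragedTubeMass := by
  rintro ⟨C₁, c₁, hC₁, hc₁, h₁⟩ ⟨α, C₂, c₂, hα0, hα1, hC₂, hc₂, h₂⟩ hS
  refine ⟨α, C₁ + C₂, c₁ * c₂, hα1, mul_pos hc₁ hc₂, ?_⟩
  intro u v ℓ hℓ huv
  -- the entrance radius
  set r : ℝ := (ℓ + 19) / 20 with hr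
  have hr1 : 1 ≤ r := by rw [hr]; linarith
  have hr0 : 0 < r := by linarith
  have hrℓ : r ≤ ℓ := by rw [hr]; linarith
  have hr20 : ℓ / 20 ≤ r := by rw [hr]; linarith
  have hrw : r ≤ ℓ / 10 + 2 := by rw [hr]; linarith
  have hℓ0 : 0 < ℓ := by linarith
  -- the two floors
  obtain ⟨N₁, hN₁⟩ := h₁ u v ℓ r hℓ huv hr20 hrw
  have hF₂ : 0 ≤ c₂ * r ^ (-C₂) := mul_nonneg hc₂.le (Real.rpow_nonneg hr0.le _)
  -- splice them at the first entrance into `B̄(v, r)`, landing radius `a = r ^ α`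
  obtain ⟨N, hN⟩ := hS u v ℓ r (r ^ α) (c₁ * ℓ ^ (-C₁)) (c₂ * r ^ (-C₂)) hF₂ hrw ⟨N₁, hN₁⟩
    (fun w hw => h₂ v w r hr1 hw)
  refine ⟨N, ?_⟩
  -- constants: `c₁ c₂ ℓ^{-(C₁+C₂)} ≤ (c₁ ℓ^{-C₁}) (c₂ r^{-C₂})` since `r ≤ ℓ` and `C₂ ≥ 0`
  have hconst : c₁ * c₂ * ℓ ^ (-(C₁ + C₂)) ≤ c₁ * ℓ ^ (-C₁) * (c₂ * r ^ (-C₂)) := by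
    have hpow : ℓ ^ (-(C₁ + C₂)) = ℓ ^ (-C₁) * ℓ ^ (-C₂) := by
      rw [neg_add, Real.rpow_add hℓ0]
    have hmono : ℓ ^ (-C₂) ≤ r ^ (-C₂) := Real.rpow_le_rpow_of_nonpos hr0 hrℓ (by linarith)
    have hnn : 0 ≤ c₁ * ℓ ^ (-C₁) := mul_nonneg hc₁.le (Real.rpow_nonneg hℓ0.le _)
    rw [hpow]
    calc c₁ * c₂ * (ℓ ^ (-C₁) * ℓ ^ (-C₂)) = c₁ * ℓ ^ (-C₁) * (c₂ * ℓ ^ (-C₂)) := by ring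
      _ ≤ c₁ * ℓ ^ (-C₁) * (c₂ * r ^ (-C₂)) :=
        mul_le_mul_of_nonneg_left (mul_le_mul_of_nonneg_left hmono hc₂.le) hnn
  refine hconst.trans (hN.trans ?_)
  -- landing radius: `r ^ α ≤ ℓ ^ α`, so the spliced family is contained in the crux's family
  have hrad : r ^ α ≤ ℓ ^ α := Real.rpow_le_rpow hr0.le hrℓ hα0
  refine Finset.sum_le_sum fun n _ => ?_
  refine Finset.sum_le_sum_of_subset_of_nonneg (fun ω hω => ?_)
    fun _ _ _ => pow_nonneg criticalFugacity_pos'.le n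
  rw [Finset.mem_filter] at hω ⊢
  exact ⟨hω.1, hω.2.1, hω.2.2.trans hrad⟩

/-- **`AveragedTubeMass_of`** — the registered composition (skeleton-check shape, as in every registered line of
the sibling crux): the crux BY NAME from the three registered stubs, i.e. `AveragedTubeMass_of_stubs` applied to
`stub_tubeEntranceFloor`, `stub_ballFunnelFloor`, `stub_entranceSplice` (proof-of-item modulo the stubs' `sorryAx`;
this declaration itself contains no `sorry`). -/
theorem AveragedTubeMass_of : AveragedTubeMass :=
  AveragedTubeMass_of_stubs stub_tubeEntranceFloor stub_ballFunnelFloor stub_entranceSplice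

/-- Audit anchor: the composition concludes the ROUTE DECL by name. -/
example : Summit.CriticalPhenomena.SAWScalingLimit.Theses.SAWEdgeOfPositiveType.AveragedTubeMass :=
  AveragedTubeMass_of

/-- Audit anchor (hypothesis form): stub signatures → the route decl, no `sorry` anywhere in the term. -/
example : TubeEntranceFloor → BallFunnelFloor → EntranceSplice →
    Summit.CriticalPhenomena.SAWScalingLimit.Theses.SAWEdgeOfPositiveType.AveragedTubeMass :=
  AveragedTubeMass_of_stubs

end Summit.CriticalPhenomena.SAWScalingLimit.Cruxes.AveragedTubeMass.Birth

end
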